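import Mathlib
import Literature.Analysis.FluidPDE.Tao2016AveragedNS.RenormalisedCascadeWaves
import Literature.Analysis.FluidPDE.Tao2016AveragedNS.SelfSimilarCascadeBlowup
import Summits.NavierStokesRegularity.NavierStokesRegularity.Theses.TaoLadderRungTwoBreak
import Summits.NavierStokesRegularity.NavierStokesRegularity.Theorems.TaoLadderRungTwoBreakOneShiftT4W76RClauses
import HarnessLib

/-!
# How ONE surviving DSS wave reads against K1(1) = `NoSurvivingDSSOne` (item stmt-NavierStokesRegularity-20205):
  an UPPER BOUND on the survival threshold, never a refutation
  (helper for item stmt-NavierStokesRegularity-20205; cell harvest/h2-tao-ladder, seat p2 g18)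

K1(1) says: for every spread `R ≥ 1` there is SOME threshold `εs(R) > 0` below which no table of
`InTableClass R` carries a non-trivial (S₁)-surviving admissible DSS wave (`TaoCascade.NoSurvivingDSS R 1`).
The quantifier on `εs` is EXISTENTIAL.  Consequently:

* `threshold_lt_of_survivingWave` — a non-trivial surviving wave of a table of spread `R'` at scale
  ratio `1+ε₀` shows that every survival threshold of every class `InTableClass R`, `R ≥ R'`, lies
  STRICTLY BELOW `ε₀`; it is an upper bound on `εs(R)`, not a contradiction.
* `not_noSurvivingDSSOne_iff` — what a refutation of K1(1) needs instead: ONE spread `R ≥ 1` carrying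
  non-trivial surviving waves at ARBITRARILY SMALL scale ratios (a sequence `ε₀ → 0` inside the class).
* `isDSSWave_reindex` / `isDSSWave_fin_one_of_unit` — bookkeeping: a DSS wave indexed by any finite type
  (the one-shift rows produce `ρ = Unit`, `π = Equiv.refl Unit`) is a DSS wave indexed by `Fin q`
  (K1(1) quantifies over `Fin q`).
* `threshold_lt_tenth_of_T4W76R_clauses` — the row of record read literally: IF the eight certificate
  clauses `DSSOneShift.T4W76R.ClausesFor bd C hC` of the one-shift row T4 @ 1/10, W = 76 hold (they are
  inhabited in the cell's COMPUTATIONAL lane only — kit j332774, `native_decide` on the pool — NOT in the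
  tree), then every survival threshold of every class `InTableClass R`, `R ≥ 15`, is `< 1/10`; and
  `noSurvivingDSSOne_threshold_lt_tenth` — K1(1) is then still consistent, with its threshold forced below
  `1/10` for all `R ≥ 15`.

HONEST FRAMING: Tao-type MODEL lattice only (cell vocabulary `IsDSSWave`, `Surviving`, `InTableClass` over
Tao 2016 §4); pure logic plus the cited row theorem; `ClausesFor` is a HYPOTHESIS here; item 20205 is
neither proved nor refuted by anything in this file; nothing here is a statement about the Navier–Stokes
equations.
-/

noncomputable section

-- the sub-problem namespace repeats the summit name by design (D-0017)
set_option linter.dupNamespace false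

namespace Summit.NavierStokesRegularity.NavierStokesRegularity.Theorems

open Literature.Analysis.FluidPDE Literature.Analysis.FluidPDE.TaoCascade
open Summit.NavierStokesRegularity.NavierStokesRegularity.Theses.TaoLadderRungTwoBreak (NoSurvivingDSSOne)

namespace NoSurvivingDSSReading

/-! ### Reindexing DSS waves -/

section Reindex

variable {ρ ρ' : Type*} [Fintype ρ] [Fintype ρ'] {m : ℕ}

/-- Summed energy is invariant under reindexing the profile family along an equivalence.
[cite: Tao2016AveragedNS, §4 Lemma 4.1 (4.9)–(4.10); cell vocabulary (`sEnergy`)] -/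
theorem sEnergy_reindex (e : ρ' ≃ ρ) (Φ : ρ → ℝ → Em m) (x : ℝ) :
    sEnergy (fun r' => Φ (e r')) x = sEnergy Φ x := by
  unfold sEnergy
  exact e.sum_comp (fun r => ‖Φ r x‖ ^ 2)

/-- Summed mass is invariant under reindexing the profile family along an equivalence.
[cite: Tao2016AveragedNS, §4 Lemma 4.1 (4.8); cell vocabulary (`sMass`)] -/
theorem sMass_reindex (e : ρ' ≃ ρ) (Φ : ρ → ℝ → Em m) :
    sMass (fun r' => Φ (e r')) = sMass Φ := by
  funext x
  unfold sMass
  exact e.sum_comp (fun r => ‖Φ r x‖)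

/-- **Reindexing a DSS wave.** Transporting the index type of the profile family along an equivalence
`e : ρ' ≃ ρ` (shape permutation conjugated accordingly) preserves `IsDSSWave`.
[cite: Tao2016AveragedNS, §4 Lemma 4.1 (iii) (4.8) in self-similar variables; cell vocabulary (`IsDSSWave`)] -/
theorem isDSSWave_reindex {ε₀ : ℝ} {α : Fin m → Fin m → Fin m → ℤ × ℤ × ℤ → ℝ} {π : Equiv.Perm ρ}
    {T : ℝ} {Φ : ρ → ℝ → Em m} (h : IsDSSWave ε₀ α π T Φ) (e : ρ' ≃ ρ) :
    IsDSSWave ε₀ α ((e.trans π).trans e.symm) T (fun r' => Φ (e r')) := by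
  refine ⟨h.delay_pos, ?_, ?_, ?_⟩
  · intro r' x
    have h1 : e (((e.trans π).trans e.symm).symm r') = π.symm (e r') := by simp
    have h2 : e (((e.trans π).trans e.symm) r') = π (e r') := by simp
    simp only [h1, h2]
    exact h.wave (e r') x
  · rw [sMass_reindex]; exact h.mass
  · obtain ⟨x₀, P, hP⟩ := h.bdd
    refine ⟨x₀, P, fun x hx => ?_⟩
    have : wEnergy 1 (fun r' => Φ (e r')) x = wEnergy 1 Φ x := by
      unfold wEnergy; rw [sEnergy_reindex]
    rw [this]; exact hP x hx

/-- A `Unit`-indexed DSS wave (period one, as produced by the one-shift rows) is a `Fin 1`-indexed DSS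
wave with the trivial shape permutation. [cite: Tao2016AveragedNS, §4 Lemma 4.1 (iii) (4.8); cell vocabulary (`IsDSSWave`)] -/
theorem isDSSWave_fin_one_of_unit {ε₀ : ℝ} {α : Fin m → Fin m → Fin m → ℤ × ℤ × ℤ → ℝ} {T : ℝ}
    {Φ : Unit → ℝ → Em m} (h : IsDSSWave ε₀ α (Equiv.refl Unit) T Φ) :
    IsDSSWave ε₀ α (Equiv.refl (Fin 1)) T (fun _ : Fin 1 => Φ ()) := by
  have h' := isDSSWave_reindex h finOneEquiv
  have hperm : ((finOneEquiv.trans (Equiv.refl Unit)).trans finOneEquiv.symm) = Equiv.refl (Fin 1) :=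
    Subsingleton.elim _ _
  rw [hperm] at h'
  exact h'

end Reindex

/-! ### The reading: one surviving wave bounds the threshold from above -/

/-- **One surviving wave = an upper bound on the threshold.** If `εs` is a survival threshold for the
class `InTableClass R` (the inner clause of `NoSurvivingDSS R 1`) and some table of spread `R' ≤ R` carries
a non-trivial (S₁)-surviving admissible DSS wave at scale ratio `1+ε₀`, then `εs < ε₀`.
[cite: Tao2016AveragedNS, §4 Thm. 4.2 (statement shape), §6.1; cell vocabulary (`NoSurvivingDSS`)] -/
theorem threshold_lt_of_survivingWave {R R' εs ε₀ : ℝ} (hR' : 0 < R') (hRR' : R' ≤ R)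
    (hthr : ∀ ε : ℝ, 0 < ε → ε ≤ εs → ∀ α : Fin 4 → Fin 4 → Fin 4 → ℤ × ℤ × ℤ → ℝ, InTableClass R α →
      ∀ (q : ℕ) (π : Equiv.Perm (Fin q)) (T : ℝ) (Φ : Fin q → ℝ → Em 4),
        IsDSSWave ε α π T Φ → Surviving 1 ε T → ∀ r x, Φ r x = 0)
    {α : Fin 4 → Fin 4 → Fin 4 → ℤ × ℤ × ℤ → ℝ} (hα : InTableClass R' α) (hε₀ : 0 < ε₀)
    {q : ℕ} {π : Equiv.Perm (Fin q)} {T : ℝ} {Φ : Fin q → ℝ → Em 4} (hw : IsDSSWave ε₀ α π T Φ)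
    (hs : Surviving 1 ε₀ T) (hne : ∃ r x, Φ r x ≠ 0) : εs < ε₀ := by
  by_contra hle
  obtain ⟨r, x, hrx⟩ := hne
  exact hrx (hthr ε₀ hε₀ (le_of_not_gt hle) α (hα.mono hR' hRR') q π T Φ hw hs r x)

/-- The same with a `Unit`-indexed wave (the shape in which the one-shift rows conclude).
[cite: Tao2016AveragedNS, §4 Thm. 4.2 (statement shape), §6.1; cell vocabulary (`NoSurvivingDSS`)] -/
theorem threshold_lt_of_survivingWave_unit {R R' εs ε₀ : ℝ} (hR' : 0 < R') (hRR' : R' ≤ R)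
    (hthr : ∀ ε : ℝ, 0 < ε → ε ≤ εs → ∀ α : Fin 4 → Fin 4 → Fin 4 → ℤ × ℤ × ℤ → ℝ, InTableClass R α →
      ∀ (q : ℕ) (π : Equiv.Perm (Fin q)) (T : ℝ) (Φ : Fin q → ℝ → Em 4),
        IsDSSWave ε α π T Φ → Surviving 1 ε T → ∀ r x, Φ r x = 0)
    {α : Fin 4 → Fin 4 → Fin 4 → ℤ × ℤ × ℤ → ℝ} (hα : InTableClass R' α) (hε₀ : 0 < ε₀)
    {T : ℝ} {Φ : Unit → ℝ → Em 4} (hw : IsDSSWave ε₀ α (Equiv.refl Unit) T Φ)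
    (hs : Surviving 1 ε₀ T) (hne : ∃ x, Φ () x ≠ 0) : εs < ε₀ := by
  obtain ⟨x, hx⟩ := hne
  exact threshold_lt_of_survivingWave hR' hRR' hthr hα hε₀ (isDSSWave_fin_one_of_unit hw) hs
    ⟨0, x, hx⟩

/-- **What a refutation of K1(1) needs.** `¬ NoSurvivingDSSOne` holds iff SOME spread class `R ≥ 1`
carries non-trivial (S₁)-surviving admissible DSS waves at ARBITRARILY SMALL scale ratios — a family along
`ε₀ → 0` inside one class, not a single wave. (Pure logic.)
[cite: Tao2016AveragedNS, §4 Thm. 4.2 (statement shape); cell vocabulary (`NoSurvivingDSS`)] -/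
theorem not_noSurvivingDSSOne_iff :
    ¬ NoSurvivingDSSOne ↔
      ∃ R : ℝ, 1 ≤ R ∧ ∀ εs : ℝ, 0 < εs → ∃ ε₀ : ℝ, 0 < ε₀ ∧ ε₀ ≤ εs ∧
        ∃ α : Fin 4 → Fin 4 → Fin 4 → ℤ × ℤ × ℤ → ℝ, InTableClass R α ∧
          ∃ (q : ℕ) (π : Equiv.Perm (Fin q)) (T : ℝ) (Φ : Fin q → ℝ → Em 4),
            IsDSSWave ε₀ α π T Φ ∧ Surviving 1 ε₀ T ∧ ∃ r x, Φ r x ≠ 0 := by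
  unfold NoSurvivingDSSOne
  push Not
  rfl

/-- **K1(1) survives any single wave, with its threshold pushed down.** If K1(1) holds and a table of
spread `R'` carries a non-trivial surviving wave at `1+ε₀`, then for every `R ≥ max 1 R'` the class
`InTableClass R` has a survival threshold `εs ∈ (0, ε₀)`.
[cite: Tao2016AveragedNS, §4 Thm. 4.2 (statement shape), §6.1; cell vocabulary (`NoSurvivingDSS`)] -/
theorem noSurvivingDSSOne_threshold_lt (hK : NoSurvivingDSSOne) {R' ε₀ : ℝ} (hR' : 0 < R')
    {α : Fin 4 → Fin 4 → Fin 4 → ℤ × ℤ × ℤ → ℝ} (hα : InTableClass R' α) (hε₀ : 0 < ε₀)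
    {q : ℕ} {π : Equiv.Perm (Fin q)} {T : ℝ} {Φ : Fin q → ℝ → Em 4} (hw : IsDSSWave ε₀ α π T Φ)
    (hs : Surviving 1 ε₀ T) (hne : ∃ r x, Φ r x ≠ 0) {R : ℝ} (hR : 1 ≤ R) (hRR' : R' ≤ R) :
    ∃ εs : ℝ, 0 < εs ∧ εs < ε₀ ∧
      ∀ ε : ℝ, 0 < ε → ε ≤ εs → ∀ β : Fin 4 → Fin 4 → Fin 4 → ℤ × ℤ × ℤ → ℝ, InTableClass R β →
        ∀ (q' : ℕ) (π' : Equiv.Perm (Fin q')) (T' : ℝ) (Ψ : Fin q' → ℝ → Em 4),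
          IsDSSWave ε β π' T' Ψ → Surviving 1 ε T' → ∀ r x, Ψ r x = 0 := by
  obtain ⟨εs, hεs, hthr⟩ := hK R hR
  exact ⟨εs, hεs, threshold_lt_of_survivingWave hR' hRR' hthr hα hε₀ hw hs hne, hthr⟩

/-! ### The row of record T4 @ 1/10, W = 76 (variant `T4W76R`), read literally -/

/-- **The one-shift row bounds the threshold: `εs(R) < 1/10` for every `R ≥ 15` — CONDITIONAL on the
row's certificate clauses.** If the eight clauses `DSSOneShift.T4W76R.ClausesFor bd C hC` hold (inhabited
in the cell's computational lane only, kit j332774; a HYPOTHESIS here), then the T4 lattice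
(`αT4 ∈ InTableClass 15`) carries a non-trivial (S₁)-surviving admissible DSS wave at `11/10`
(`T4W76R.exists_inTableClass_surviving_dssWave_of_clauses`), so every survival threshold of every class
`InTableClass R`, `R ≥ 15`, is `< 1/10`.
[cite: Tao2016AveragedNS, §4 Thm. 4.2 (statement shape), §6.1, §6.3–6.4 (renormalisation certificates); cell vocabulary; module …OneShiftT4W76RClauses] -/
theorem threshold_lt_tenth_of_T4W76R_clauses {bd : DSSOneShift.T4W76.BoxData}
    {C : (DSSOneShift.T4W76R.frame bd).WState × ℝ → (DSSOneShift.T4W76R.frame bd).WState × ℝ}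
    {hC : ∀ r, C r = 0 → r = 0} (h : DSSOneShift.T4W76R.ClausesFor bd C hC) {R εs : ℝ} (hR : 15 ≤ R)
    (hthr : ∀ ε : ℝ, 0 < ε → ε ≤ εs → ∀ α : Fin 4 → Fin 4 → Fin 4 → ℤ × ℤ × ℤ → ℝ, InTableClass R α →
      ∀ (q : ℕ) (π : Equiv.Perm (Fin q)) (T : ℝ) (Φ : Fin q → ℝ → Em 4),
        IsDSSWave ε α π T Φ → Surviving 1 ε T → ∀ r x, Φ r x = 0) :
    εs < 1 / 10 := by
  obtain ⟨α, hα, T, Φ, _hT, hw, hs, hne⟩ :=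
    DSSOneShift.T4W76R.exists_inTableClass_surviving_dssWave_of_clauses bd h
  exact threshold_lt_of_survivingWave_unit (by norm_num) hR hthr hα (by norm_num) hw hs hne

/-- **K1(1) and the row coexist, with `εs(R) < 1/10` for all `R ≥ 15`** (conditional on the row's
clauses, as above): the row is an UPPER BOUND on K1(1)'s threshold, not evidence against K1(1).
[cite: Tao2016AveragedNS, §4 Thm. 4.2 (statement shape), §6.1; cell vocabulary (`NoSurvivingDSS`)] -/
theorem noSurvivingDSSOne_threshold_lt_tenth (hK : NoSurvivingDSSOne) {bd : DSSOneShift.T4W76.BoxData}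
    {C : (DSSOneShift.T4W76R.frame bd).WState × ℝ → (DSSOneShift.T4W76R.frame bd).WState × ℝ}
    {hC : ∀ r, C r = 0 → r = 0} (h : DSSOneShift.T4W76R.ClausesFor bd C hC) {R : ℝ} (hR : 15 ≤ R) :
    ∃ εs : ℝ, 0 < εs ∧ εs < 1 / 10 ∧
      ∀ ε : ℝ, 0 < ε → ε ≤ εs → ∀ β : Fin 4 → Fin 4 → Fin 4 → ℤ × ℤ × ℤ → ℝ, InTableClass R β →
        ∀ (q' : ℕ) (π' : Equiv.Perm (Fin q')) (T' : ℝ) (Ψ : Fin q' → ℝ → Em 4),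
          IsDSSWave ε β π' T' Ψ → Surviving 1 ε T' → ∀ r x, Ψ r x = 0 := by
  obtain ⟨εs, hεs, hthr⟩ := hK R (le_trans (by norm_num) hR)
  exact ⟨εs, hεs, threshold_lt_tenth_of_T4W76R_clauses h hR hthr, hthr⟩

end NoSurvivingDSSReading

end Summit.NavierStokesRegularity.NavierStokesRegularity.Theorems
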